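import Summits.ValiantsHypothesis.ValiantsHypothesis.Theorems.VPBoundarySquareToricInterpolation
import Summits.ValiantsHypothesis.ValiantsHypothesis.Theorems.VPBoundarySquarePresentableSplit
import Literature.Computability.AlgebraicComplexity.BorderComplexityAlder
import HarnessLib

/-!
# VP-boundary square — the TORIC rung of `U`: toric limits of `VP` lie in `closure(VP) ∩ VNP`

Decomp lens-3 (border / debordering axis), g10 node «toric arcs». Route of record
`route-ValiantsHypothesis-VPBoundarySquare` (`closes (Q) (P) : ValiantsHypothesis`,
`Q := EmptyBoundarySeparates`, `P := CollapseEmptiesBoundary`); `P`'s road is the banked support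
`U := ClosureDefinable` («`closure(VP) ∩ p-fam ⊆ VNP`», open in print, GMQ16 p. 3), whose completion
ladder had exactly one `ℂ`-theorem rung beyond polynomial order: BDS24's presentable class
`closure_ε(VP) ⊆ VNPnb^ℂ` — into `VNPnb`, NOT `VNP`. The engine file
`Theorems/VPBoundarySquareToricInterpolation` adds a fact-free, GRH-free `ℂ`-rung at EXPONENTIAL order
landing in `VNP` proper (★ `isVNPFamily_weightedHomogeneousComponent`: exponential-weight slices of
`VP` families are `VNP` families). THIS FILE states it in the route's vocabulary:

* `IsToricVPLimit v g` — `g_n` is a weight slice `weightedHomogeneousComponent w_n b_n f_n` of a `VP`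
  family for weights/targets of polynomial bit-length; `IsToricVPLimit.isVNPFamily` (★ the rung);
* `isVPBarFamily_initialForm` — toric INITIAL FORMS (`b_n` minimal on the support, i.e. the limits
  `lim_ε ε^{-b_n} f_n(ε^{w_n} x)` of one-parameter-subgroup degenerations) are border points
  (Bürgisser 2024 Rem. 4.21, tree `borderComplexity_weightedHomogeneousComponent_le`, + Alder's theorem
  `isVPBarFamily_iff_isPBounded_borderComplexity`), so toric initial forms of `VP` lie in
  `closure(VP) ∩ VNP` unconditionally;
* `ToricCompletion` («every p-family in `closure(VP)` is a toric slice of a `VP` family», the toric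
  analogue of GMQ16 Question 4.44 / of the route child `PresentableCompletion`, `@[conjecture]`,
  UNDECIDED) implies `U` (`closureDefinable_of_toricCompletion`) and hence `P`
  (`collapseEmptiesBoundary_of_toricCompletion`) with NO `GRH` and NO `Bur24_thm_4_10_2` — contrast
  `PresentableCompletion`, which reaches `P` only through `{ERH, Bur24_thm_4_10_2}`
  (`Theorems/VPBoundarySquareNbTransfer`); it is implied by `∂VP = ∅`
  (`toricCompletion_of_boundaryEmpty`), hence consistent with `VP = VNP = closure(VP)`;
* `valiant_and_boundary_of_toricEscape` — ONE toric initial form of a `VP` family that is not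
  p-computable proves `VP ≠ VNP` AND `closure(VP) ⊄ VP` simultaneously (the cheapest typed shape of an
  `M`-road witness for the residual `Q`).

TAGS (workshop): rung = THEOREM (kernel, 0 sorry, no named fact); `ToricCompletion` = UNDECIDED
(stated test: is the closure of width-2 ABPs / of a fixed `VP_{n^e}` exhausted by torus slices of
polynomial bit-length? torus-ORBIT closures satisfy it by definition; general orbit closures need
`G[[t]]`-jets in Cartan normal form and the jet part is what a toric arc lacks);
NOT A DESCENT below `PresentableCompletion`: for INITIAL forms the toric arc `x ↦ ε^{w} x` is
presentable (monomial entries), so toric initial-form limits are presentable limits, while as typed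
(arbitrary target `b_n`, an exact slice rather than a limit) the two completion statements are
incomparable — and `ToricCompletion` already yields `U` outright, which `PresentableCompletion` does
only through `{ERH, Bur24_thm_4_10_2}`; it is a corner of the completion ladder, filed as NO item
(cap, anti-descent); residual of the route unchanged (`Q`).

References: Grochow–Mulmuley–Qiao 2016, §1, §3.3, Cor. 4.2, Question 4.44; Bürgisser 2024
(arXiv:2406.06217) Rem. 4.21, Def. 4.23, Prop. 3.1; Bürgisser 2000 Def. 2.4–2.5; BLMW 2011 §9.3.
-/

noncomputable section

set_option linter.dupNamespace false

open MvPolynomial Finset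
open Literature.Computability.AlgebraicComplexity

open Summit.ValiantsHypothesis.ValiantsHypothesis.Theses.VPBoundarySquare
open Summit.ValiantsHypothesis.ValiantsHypothesis.Theorems.VPBoundarySquarePresentableSplit
open Summit.ValiantsHypothesis.ValiantsHypothesis.Theorems.VPBoundarySquareToricInterpolation

namespace Summit.ValiantsHypothesis.ValiantsHypothesis.Theorems.VPBoundarySquareToricSlices

/-! ### The toric rung in the route's vocabulary -/

section Rung

/-- **Toric limits of `VP`**: `g` is, level by level, a weight slice
`weightedHomogeneousComponent w_n b_n f_n` of a `VP` family `f` for weights and targets of polynomial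
bit-length (exponential ORDER of approximation). Initial forms (`b_n` minimal on the support) are the
limits `lim_{ε→0} ε^{-b_n} f_n(ε^{w_n} x)` of one-parameter-subgroup (torus) degenerations; weights of
arbitrary size induce the same initial forms as weights of polynomial bit-length (a cell of the
arrangement `⟨w, m - m'⟩ = 0`, `|m|,|m'| ≤ deg f_n`, contains a small integer point), so the
bit-length proviso is a normalisation, not a restriction. [cite: GrochowMulmuleyQiao2016, §3.3 (p-definable one-parameter degenerations)] -/
def IsToricVPLimit (v : ℕ → ℕ) (g : ∀ n, MvPolynomial (Fin (v n)) ℂ) : Prop :=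
  ∃ (f : ∀ n, MvPolynomial (Fin (v n)) ℂ) (w : ∀ n, Fin (v n) → ℕ) (b p : ℕ → ℕ),
    IsVPFamily f ∧ IsPBounded p ∧ (∀ n j, w n j < 2 ^ p n) ∧ (∀ n, b n < 2 ^ p n) ∧
    ∀ n, g n = weightedHomogeneousComponent (w n) (b n) (f n)

/-- ★ **The toric rung of `U`**: toric limits of `VP` families are `VNP` families over `ℂ` —
unconditionally, with no named fact. [cite: GrochowMulmuleyQiao2016, Cor. 4.2 (toric case)] -/
theorem IsToricVPLimit.isVNPFamily {v : ℕ → ℕ} {g : ∀ n, MvPolynomial (Fin (v n)) ℂ}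
    (h : IsToricVPLimit v g) : IsVNPFamily g := by
  obtain ⟨f, w, b, p, hf, hp, hw, hb, hg⟩ := h
  rw [show g = fun n => weightedHomogeneousComponent (w n) (b n) (f n) from funext hg]
  exact isVNPFamily_weightedHomogeneousComponent hf w b hp hw hb

/-- `ℕ`-weights as `ℤ`-weights: the weight slices agree (so Bürgisser's Rem. 4.21, stated in the tree
for `ℤ`-weights, applies to `ℕ`-weight slices); the monomial-weight identity
`⟨(w : ℤ), m⟩ = (⟨w, m⟩ : ℕ)` is the tree's `…BorderApolarityFixedWitnessObstructionQP.weight_natCast_eq`,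
re-derived inline here to keep this file's imports inside the lineage. [folklore] -/
theorem weightedHomogeneousComponent_natCast_eq {σ : Type*} {R : Type*} [CommSemiring R]
    (w : σ → ℕ) (b : ℕ) (f : MvPolynomial σ R) :
    weightedHomogeneousComponent (fun j => (w j : ℤ)) (b : ℤ) f = weightedHomogeneousComponent w b f := by
  classical
  ext m
  have hwt : Finsupp.weight (fun j => (w j : ℤ)) m = ((Finsupp.weight w m : ℕ) : ℤ) := by
    rw [Finsupp.weight_apply, Finsupp.weight_apply, Finsupp.sum, Finsupp.sum, Nat.cast_sum]
    refine sum_congr rfl fun j _ => ?_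
    simp [smul_eq_mul]
  rw [coeff_weightedHomogeneousComponent, coeff_weightedHomogeneousComponent, hwt]
  simp only [Nat.cast_inj]

/-- **Toric initial forms are border points** (Bürgisser 2024 Rem. 4.21 + Alder's theorem, both in the
tree): if `b_n ≤ ⟨w_n, m⟩` on the support of `f_n` (so the slice is the initial form `in_{w_n} f_n`),
the family of slices of a `VP` family is in `closure(VP)` — for weights of ANY size.
[cite: Burgisser2024Completeness, Remark 4.21 (§4.7)] -/
theorem isVPBarFamily_initialForm {v : ℕ → ℕ} {f : ∀ n, MvPolynomial (Fin (v n)) ℂ}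
    (hf : IsVPFamily f) (w : ∀ n, Fin (v n) → ℕ) (b : ℕ → ℕ)
    (hmin : ∀ n, ∀ m ∈ (f n).support, b n ≤ Finsupp.weight (w n) m) :
    IsVPBarFamily (fun n => weightedHomogeneousComponent (w n) (b n) (f n)) := by
  rw [isVPBarFamily_iff_isPBounded_borderComplexity]
  refine (IsPBounded.add_holds (IsPBounded.add_holds hf.2 hf.1.1) (IsPBounded.const 1)).mono
    fun n => ?_
  dsimp only
  rw [← weightedHomogeneousComponent_natCast_eq]
  refine (borderComplexity_weightedHomogeneousComponent_le (f n) _ _ fun m hm => ?_).trans ?_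
  · have hwt : Finsupp.weight (fun j => (w n j : ℤ)) m = ((Finsupp.weight (w n) m : ℕ) : ℤ) := by
      rw [Finsupp.weight_apply, Finsupp.weight_apply, Finsupp.sum, Finsupp.sum, Nat.cast_sum]
      refine sum_congr rfl fun j _ => ?_
      simp [smul_eq_mul]
    rw [hwt]
    exact_mod_cast hmin n m hm
  · simp

/-- **Toric completion** — the toric analogue of GMQ16 Question 4.44 / of the route child
`PresentableCompletion`: every p-family in `closure(VP)` is a toric limit of a `VP` family.
UNDECIDED (stated test: is the closure of width-2 ABPs, or of any fixed `VP_{n^e}`, exhausted by torus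
limits of polynomial bit-length? torus-ORBIT closures satisfy it by definition; general orbit closures
need `G[[t]]`-jets in Cartan normal form and the jet part is exactly what a toric arc lacks). It is
NOT a descent below `PresentableCompletion`: for initial forms (`b_n` minimal) the toric arc
`f(ε^{w} x)` (`ε^{w_j}` by repeated squaring) IS a presentable approximation, but as typed (any target
`b_n`, an exact slice) the two statements are incomparable, and this one already reaches `U` and `P`
with NO GRH and NO named fact (next two theorems) — its payoff; it is implied by `∂VP = ∅`
(`toricCompletion_of_boundaryEmpty`), hence consistent with `VP = VNP = closure(VP)`. [cite: GrochowMulmuleyQiao2016, Question 4.44 (p-family form), toric analogue] -/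
@[conjecture]
def ToricCompletion : Prop :=
  ∀ (v : ℕ → ℕ) (g : ∀ n, MvPolynomial (Fin (v n)) ℂ), IsPFamily g → IsVPBarFamily g →
    IsToricVPLimit v g

/-- `ToricCompletion → U` (`closure(VP) ∩ p-fam ⊆ VNP`), fact-free. [cite: GrochowMulmuleyQiao2016, Cor. 4.2 with Question 4.44] -/
theorem closureDefinable_of_toricCompletion (h : ToricCompletion) : ClosureDefinable :=
  fun v g hpg hbar => (h v g hpg hbar).isVNPFamily

/-- `ToricCompletion → P` (`VP = VNP ⟹ ∂VP = ∅`), with no GRH and no named fact — contrast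
`collapseDebordersPresentable_of_ERH : ERH → Bur24_thm_4_10_2 ℂ → CollapseDebordersPresentable`.
[cite: GrochowMulmuleyQiao2016, Cor. 4.2] [cite: Burgisser2000, Def. 2.4–2.5] -/
theorem collapseEmptiesBoundary_of_toricCompletion (h : ToricCompletion) : CollapseEmptiesBoundary :=
  fun hEq v g hpg hbar => isPComputable_of_isVNPFamily_of_vp_eq_vnp hEq (h v g hpg hbar).isVNPFamily

/-- Consistency: `∂VP = ∅` implies `ToricCompletion` (a p-computable family is its own weight-`0`
slice for the zero weights), so `ToricCompletion` does not secretly assert `closure(VP) ⊄ VP` or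
`VP ≠ VNP`. [folklore] -/
theorem toricCompletion_of_boundaryEmpty
    (hA : ∀ (v : ℕ → ℕ) (g : ∀ n, MvPolynomial (Fin (v n)) ℂ), IsPFamily g → IsVPBarFamily g →
      IsPComputable g) : ToricCompletion := by
  intro v g hpg hbar
  refine ⟨g, fun n _ => 0, fun _ => 0, fun _ => 0, ⟨hpg, hA v g hpg hbar⟩, IsPBounded.const 0,
    fun n j => by norm_num, fun n => by norm_num, fun n => ?_⟩
  classical
  ext m
  rw [coeff_weightedHomogeneousComponent, if_pos]
  simp [Finsupp.weight_apply]

/-- ★ **One toric escape proves both `S` and `M`**: if some toric initial form of a `VP` family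
(weights of polynomial bit-length, `b_n` minimal on the support) is NOT p-computable, then
`VP_ℂ ≠ VNP_ℂ` (it is a `VNP` family outside `VP`) AND `closure(VP) ⊄ VP` (it is a border family
outside `VP`) — the cheapest typed shape of a witness for the `M`-road of the residual `Q`.
[cite: GrochowMulmuleyQiao2016, §1 (the question closure(VP) = VP) and Cor. 4.2] -/
theorem valiant_and_boundary_of_toricEscape {v : ℕ → ℕ} {f : ∀ n, MvPolynomial (Fin (v n)) ℂ}
    (hf : IsVPFamily f) (w : ∀ n, Fin (v n) → ℕ) (b : ℕ → ℕ) {p : ℕ → ℕ} (hp : IsPBounded p)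
    (hw : ∀ n j, w n j < 2 ^ p n) (hb : ∀ n, b n < 2 ^ p n)
    (hmin : ∀ n, ∀ m ∈ (f n).support, b n ≤ Finsupp.weight (w n) m)
    (hnc : ¬ IsPComputable (fun n => weightedHomogeneousComponent (w n) (b n) (f n))) :
    ValiantsHypothesis ∧ BoundaryOfVPNonempty := by
  have hvnp := isVNPFamily_weightedHomogeneousComponent hf w b hp hw hb
  have hbar := isVPBarFamily_initialForm hf w b hmin
  exact ⟨fun hEq => hnc (isPComputable_of_isVNPFamily_of_vp_eq_vnp hEq hvnp),
    fun hA => hnc (hA v _ hvnp.1 hbar)⟩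

end Rung

end Summit.ValiantsHypothesis.ValiantsHypothesis.Theorems.VPBoundarySquareToricSlices
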